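import Literature.AlgebraicGeometry.HodgeTheory.BettiHodgeNumbersOfHodgeModels
import Literature.AlgebraicGeometry.HodgeTheory.AlgebraicClassesCupSubmaximalDegree
import HarnessLib

/-!
# Pure type is Serre–Poincaré dual: `H^{2p}(X)` is purely of type `(p,p)` iff `H^{2n−2p}(X)` is purely of type `(n−p, n−p)`; hence
# `Hg(H^{2p}(X)) = 1 ⟺ Hg(H^{2n−2p}(X)) = 1`, and `p_g(X) = 0 ⟹` the CURVE classes: `H^{2n−2}(X(ℂ); ℚ)` is all algebraic, `Hg(H^{2n−2}(X)) = 1`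
# (Voisin I Thm. 6.25, Cor. 6.12–6.13, proof of Thm. 6.33, Thm. 11.30; Kerr–Pearlstein 2011 §3.1; Green–Griffiths–Kerr §I.C p. 45)

Family `hodge`, lane `lit-hodgefound` (Track 2 foundations library; Layers A1/A4), layer `Literature/AlgebraicGeometry/HodgeTheory`.  THEOREMS ONLY (no
definition, no named fact, no instance; D-0026 net debt `0`).  Sequel of the seat's g24-#3 `BettiHodgeGroupTrivialPureTypeDegrees` (degrees `0`, `2n`, and `2` when
`p_g = 0`) and g24-#4 `BettiHodgeNumbersOfHodgeModels` (the Hodge numbers of the lane's `Hᵏ(X)` and their Serre–Poincaré duality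
`h^{a,b}(H^{a+b}(X)) = h^{n−a,n−b}(H^{2n−a−b}(X))`): the Hodge-number criterion for pure type is SYMMETRIC under `k ↦ 2n − k`, so the triviality of the Hodge
group of `H^{2p}(X)` and of `H^{2n−2p}(X)` are equivalent, and the case `p = 1` — the geometric genus — controls the degree `2n − 2` of the CURVE classes,
where the Hodge conjecture is known (hard Lefschetz `Lⁿ⁻² : H² ⥲ H^{2n−2}` + Lefschetz `(1,1)`; the tree's `mem_algebraicClasses_of_lefschetzRange_holds`): for a
smooth projective `X` of dimension `n ≥ 1` with `p_g(X) = 0`, EVERY class of `H^{2n−2}(X(ℂ); ℚ)` is a `ℚ`-combination of classes of curves.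

THE PRINTS.  C. Voisin (2002) [VoisinHodgeI2002] §6.3.2 proof of Thm. 6.33 (PDF p0129) «Note that we used Poincaré duality here» (`h^{a,b} = h^{n−a,n−b}`, from
Thm. 6.25 hard Lefschetz and Cor. 6.12 Hodge symmetry; the tree's `HodgeModel.finrank_hodgePQ_duality`), Cor. 6.13, §7.1.2, Thm. 11.30.  M. Kerr, G. Pearlstein
(2011) [KerrPearlstein2011] §3.1 (the Hodge conjecture holds for curve classes, `p = n − 1`).  M. Green, P. Griffiths, M. Kerr (2012) [GreenGriffithsKerr2012] §I.C
p0045 «since `V_ℂ = ⊕_p V^{p,p}`, `φ` is trivial and so `M_φ = {1}`».  J. Carlson, S. Müller-Stach, C. Peters (2017) [CarlsonMullerStachPeters2017] §15.2 Examples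
15.2.4 (i) (p0369).  C. Voisin (2003) [VoisinHodgeII2003] §11.1.1 (PDF p0268) «`p_g(X) := dim H^{2,0}(X)`».

THE OBJECTS (all the tree's).  `X : SchemeOver ℂ`, `hX : IsSmoothProjective n X`, `hHD : exists_isReal_hodgeModel`; `Hᵏ(X) = BettiUniverse.hodge hHD hX k` with
`hodgeNumber`, `hodgeClasses`, `hodgeGroupBaseChange K`, `mumfordTateGroupBaseChange K`; `algebraicClasses X p = NᵖH^{2p}(X(ℂ); ℂ)`; `ofRatClass`.

WHAT IS PROVED.
* §1 DUALITY OF PURE TYPE (`p + q = n`): `BettiUniverse.hodgeNumber_hodge_duality_of_eq` (g24-#4's duality with free degree variables),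
  `BettiUniverse.forall_hodgeNumber_eq_zero_of_dual` (the Hodge-number criterion in degree `2p` implies it in degree `2q`),
  **`BettiUniverse.hodgeClasses_hodge_eq_top_iff_dual`** (`Hdgᵖ(H^{2p}(X)) = ⊤ ⟺ Hdg^q(H^{2q}(X)) = ⊤`),
  **`BettiUniverse.hodgeGroupBaseChange_hodge_eq_bot_iff_dual`** (`Hg(H^{2p}(X))(K) = 1 ⟺ Hg(H^{2q}(X))(K) = 1`, every field `K ⊇ ℚ`).
* §2 THE CURVE CLASSES (`n ≥ 1`, degree `2(n−1)`): **`BettiUniverse.hodgeClasses_hodge_curveDegree_eq_top_iff`** (`Hdg^{n−1}(H^{2n−2}(X)) = ⊤ ⟺ p_g(X) = 0`),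
  **`BettiUniverse.hodgeGroupBaseChange_hodge_curveDegree_eq_bot_iff`** (`Hg(H^{2n−2}(X))(K) = 1 ⟺ p_g(X) = 0`),
  `BettiUniverse.mem_mumfordTateGroupBaseChange_hodge_curveDegree_iff_of_pg_zero` (`MT(H^{2n−2}(X))(K) = K^× · id`, `n ≥ 2`),
  **`ofRatClass_mem_algebraicClasses_curveDegree_of_pg_zero`** (`p_g(X) = 0 ⟹ v ⊗ 1 ∈ N^{n−1}H^{2n−2}` for EVERY `v ∈ H^{2n−2}(X(ℂ); ℚ)`),
  `ofRatClass_mem_algebraicClasses_curveDegree_of_exists_hodgeModel` (Arapura's rendering `∃ A, dim H^{2,0}_A = 0`).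

DEVIATIONS / SCOPE.  On points, Tannaka-free.  Odd degrees are not pure (`−1 · id ∈ Hg`) and are not treated.  `n = 0` is excluded from §2 (no degree `2n − 2`).

## References
* [VoisinHodgeI2002] C. Voisin, *Hodge Theory and Complex Algebraic Geometry I* (2002) — §6.1.3 Cor. 6.12–6.13, §6.2.3 Thm. 6.25 / Rem. 6.27, §6.3.2 proof of Thm. 6.33
  (PDF p. 129), §7.1.2, Thm. 11.30, §11.3.1.
* [KerrPearlstein2011] M. Kerr, G. Pearlstein, *An exponential history of functions with logarithmic growth* (2011) — §3.1.
* [GreenGriffithsKerr2012] M. Green, P. A. Griffiths, M. Kerr, *Mumford–Tate Groups and Domains* (2012) — §I.C p. 45.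
* [CarlsonMullerStachPeters2017] J. Carlson, S. Müller-Stach, C. Peters, *Period Mappings and Period Domains*, 2nd ed. (2017) — §15.2 Examples 15.2.4 (i) (p. 369).
* [VoisinHodgeII2003] C. Voisin, *Hodge Theory and Complex Algebraic Geometry II* (2003) — §11.1.1 (PDF p. 268).
* [Arapura2022] D. Arapura, *Hodge cycles and the Leray filtration*, Pacific J. Math. 319 (2022) — proof of Cor. 1.5 (p. 5).

## Provenance
Lane `lit-hodgefound` (Hodge path, Track 2), prover seat `lit-hodgefound-p29` (generation 24), self-proposed row g24-#5 (dual degrees of g24-#3/#4).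
-/

noncomputable section

open scoped TensorProduct
open CategoryTheory Module
open Literature.AlgebraicTopology.SingularHomology

namespace Literature.AlgebraicGeometry.HodgeTheory

open Literature.AlgebraicGeometry.Motives
open Literature.AlgebraicGeometry.Motives.HodgeStructure

universe w

variable {n : ℕ} {X : SchemeOver ℂ}

/-! ### §1 Pure type is Serre–Poincaré dual -/

/-- g24-#4's duality `h^{a,b}(H^{a+b}(X)) = h^{a',b'}(H^{a'+b'}(X))` (`a + a' = n = b + b'`) with free degree variables `k = a + b`, `k' = a' + b'`.
[cite: VoisinHodgeI2002, §6.3.2 proof of Thm. 6.33, §6.2.3 Thm. 6.25 and §6.1.3 Cor. 6.12] -/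
theorem BettiUniverse.hodgeNumber_hodge_duality_of_eq (hHD : exists_isReal_hodgeModel) (hX : IsSmoothProjective n X) {k k' a b a' b' : ℕ} (hk : a + b = k)
    (hk' : a' + b' = k') (ha : a + a' = n) (hb : b + b' = n) :
    (BettiUniverse.hodge hHD hX k).hodgeNumber a b = (BettiUniverse.hodge hHD hX k').hodgeNumber a' b' := by
  subst hk
  subst hk'
  exact BettiUniverse.hodgeNumber_hodge_duality hHD hX ha hb

/-- **The Hodge-number criterion for pure type is dual**: if `h^{a,b}(H^{2p}(X)) = 0` for all `a + b = 2p`, `a ≠ p`, then `h^{a,b}(H^{2q}(X)) = 0` for all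
`a + b = 2q`, `a ≠ q`, whenever `p + q = n` (duality for `a, b ≤ n`; no `(a,b)`-classes with `a > n` or `b > n`).
[cite: VoisinHodgeI2002, §6.3.2 proof of Thm. 6.33 and §6.1.3 Cor. 6.12–6.13] -/
theorem BettiUniverse.forall_hodgeNumber_eq_zero_of_dual (hHD : exists_isReal_hodgeModel) (hX : IsSmoothProjective n X) {p q : ℕ} (hpq : p + q = n)
    (h : ∀ a b : ℕ, a + b = 2 * p → (a : ℤ) ≠ p → (BettiUniverse.hodge hHD hX (2 * p)).hodgeNumber a b = 0) :
    ∀ a b : ℕ, a + b = 2 * q → (a : ℤ) ≠ q → (BettiUniverse.hodge hHD hX (2 * q)).hodgeNumber a b = 0 := by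
  intro a b hab haq
  by_cases ha : n < a
  · exact BettiUniverse.hodgeNumber_hodge_eq_zero_of_lt_fst hHD hX hab ha
  by_cases hb : n < b
  · exact BettiUniverse.hodgeNumber_hodge_eq_zero_of_lt_snd hHD hX hab hb
  rw [BettiUniverse.hodgeNumber_hodge_duality_of_eq hHD hX hab (show (n - a) + (n - b) = 2 * p by omega) (by omega) (by omega)]
  refine h (n - a) (n - b) (by omega) fun heq => haq ?_
  rw [Nat.cast_sub (le_of_not_gt ha)] at heq
  omega

/-- **`H^{2p}(X)` is purely of type `(p,p)` iff `H^{2q}(X)` is purely of type `(q,q)`** (`p + q = n`): `Hdgᵖ(H^{2p}(X)) = ⊤ ⟺ Hdg^q(H^{2q}(X)) = ⊤`.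
[cite: VoisinHodgeI2002, §6.3.2 proof of Thm. 6.33 and §11.3.1 Def. 11.28] -/
theorem BettiUniverse.hodgeClasses_hodge_eq_top_iff_dual (hHD : exists_isReal_hodgeModel) (hX : IsSmoothProjective n X) {p q : ℕ} (hpq : p + q = n) :
    (BettiUniverse.hodge hHD hX (2 * p)).hodgeClasses p = ⊤ ↔ (BettiUniverse.hodge hHD hX (2 * q)).hodgeClasses q = ⊤ := by
  haveI := BettiUniverse.finite hX (2 * p)
  haveI := BettiUniverse.finite hX (2 * q)
  have key : ∀ {p q : ℕ}, p + q = n → (BettiUniverse.hodge hHD hX (2 * p)).hodgeClasses p = ⊤ →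
      (BettiUniverse.hodge hHD hX (2 * q)).hodgeClasses q = ⊤ := by
    intro p q hpq h
    haveI := BettiUniverse.finite hX (2 * p)
    refine BettiUniverse.hodgeClasses_hodge_eq_top_of_forall_hodgeNumber_eq_zero hHD hX (by push_cast; ring) ?_
    refine BettiUniverse.forall_hodgeNumber_eq_zero_of_dual hHD hX hpq fun a b hab hap => ?_
    have hne : (a : ℤ) ≠ (p : ℤ) := hap
    exact_mod_cast (BettiUniverse.hodge hHD hX (2 * p)).hodgeNumber_eq_zero_of_hodgeClasses_eq_top (p := (p : ℤ)) (by push_cast; ring) h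
      (p' := (a : ℤ)) (q' := (b : ℤ)) hne
  exact ⟨key hpq, key (by omega)⟩

/-- **`Hg(H^{2p}(X))(K) = 1 ⟺ Hg(H^{2q}(X))(K) = 1`** for `p + q = n` and every field `K ⊇ ℚ` (pure type is dual; g24-#2).
[cite: GreenGriffithsKerr2012, §I.C p. 45 (before Remark (I.C.14))] [cite: VoisinHodgeI2002, §6.3.2 proof of Thm. 6.33] -/
theorem BettiUniverse.hodgeGroupBaseChange_hodge_eq_bot_iff_dual [HodgeTensorFacts.{0, 0}] (hHD : exists_isReal_hodgeModel) (hX : IsSmoothProjective n X)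
    (K : Type w) [Field K] [Algebra ℚ K] {p q : ℕ} (hpq : p + q = n) [Module.Finite ℚ (bettiCohomology X (2 * p))] [Module.Finite ℚ (bettiCohomology X (2 * q))] :
    (BettiUniverse.hodge hHD hX (2 * p)).hodgeGroupBaseChange K = ⊥ ↔ (BettiUniverse.hodge hHD hX (2 * q)).hodgeGroupBaseChange K = ⊥ := by
  rw [(BettiUniverse.hodge hHD hX (2 * p)).hodgeGroupBaseChange_eq_bot_iff_hodgeClasses_eq_top K (p := (p : ℤ)) (by push_cast; ring),
    (BettiUniverse.hodge hHD hX (2 * q)).hodgeGroupBaseChange_eq_bot_iff_hodgeClasses_eq_top K (p := (q : ℤ)) (by push_cast; ring)]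
  exact BettiUniverse.hodgeClasses_hodge_eq_top_iff_dual hHD hX hpq

/-! ### §2 The curve classes: degree `2(n − 1)` and the geometric genus -/

/-- **`Hdg^{n−1}(H^{2n−2}(X)) = H^{2n−2}(X(ℂ); ℚ) ⟺ p_g(X) = 0`** (`n ≥ 1`; the dual of g24-#3's degree-`2` criterion: `h^{n,n−2} = h^{2,0}`).
[cite: VoisinHodgeI2002, §6.3.2 proof of Thm. 6.33 and §6.1.3 Cor. 6.12] [cite: VoisinHodgeII2003, §11.1.1 (PDF p. 268)] -/
theorem BettiUniverse.hodgeClasses_hodge_curveDegree_eq_top_iff (hHD : exists_isReal_hodgeModel) (hX : IsSmoothProjective n X) (hn : 1 ≤ n) :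
    (BettiUniverse.hodge hHD hX (2 * (n - 1))).hodgeClasses (n - 1 : ℕ) = ⊤ ↔ (BettiUniverse.hodge hHD hX 2).hodgeNumber 2 0 = 0 := by
  rw [← BettiUniverse.hodgeClasses_hodge_two_eq_top_iff hHD hX,
    ← BettiUniverse.hodgeClasses_hodge_eq_top_iff_dual hHD hX (p := 1) (q := n - 1) (by omega)]
  norm_cast

/-- **`Hg(H^{2n−2}(X))(K) = 1 ⟺ p_g(X) = 0`** (`n ≥ 1`, every field `K ⊇ ℚ`). [cite: GreenGriffithsKerr2012, §I.C p. 45 (before Remark (I.C.14))]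
[cite: CarlsonMullerStachPeters2017, §15.2 Examples 15.2.4 (i) (p. 369)] [cite: VoisinHodgeII2003, §11.1.1 (PDF p. 268)] -/
theorem BettiUniverse.hodgeGroupBaseChange_hodge_curveDegree_eq_bot_iff [HodgeTensorFacts.{0, 0}] (hHD : exists_isReal_hodgeModel)
    (hX : IsSmoothProjective n X) (hn : 1 ≤ n) (K : Type w) [Field K] [Algebra ℚ K] [Module.Finite ℚ (bettiCohomology X (2 * (n - 1)))] :
    (BettiUniverse.hodge hHD hX (2 * (n - 1))).hodgeGroupBaseChange K = ⊥ ↔ (BettiUniverse.hodge hHD hX 2).hodgeNumber 2 0 = 0 := by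
  rw [(BettiUniverse.hodge hHD hX (2 * (n - 1))).hodgeGroupBaseChange_eq_bot_iff_hodgeClasses_eq_top K (p := ((n - 1 : ℕ) : ℤ)) (by push_cast; ring),
    BettiUniverse.hodgeClasses_hodge_curveDegree_eq_top_iff hHD hX hn]

/-- **`p_g(X) = 0 ⟹ MT(H^{2n−2}(X))(K) = K^× · id` exactly** (`n ≥ 2`, every field `K ⊇ ℚ`). [cite: CarlsonMullerStachPeters2017, §15.2 Examples 15.2.4 (i) (p. 369)]
[cite: GreenGriffithsKerr2012, §I.B p. 35 and §I.C p. 45] -/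
theorem BettiUniverse.mem_mumfordTateGroupBaseChange_hodge_curveDegree_iff_of_pg_zero [HodgeTensorFacts.{0, 0}] (hHD : exists_isReal_hodgeModel)
    (hX : IsSmoothProjective n X) (hn : 2 ≤ n) (K : Type w) [Field K] [Algebra ℚ K] [Module.Finite ℚ (bettiCohomology X (2 * (n - 1)))]
    (h20 : (BettiUniverse.hodge hHD hX 2).hodgeNumber 2 0 = 0)
    (γ : (K ⊗[ℚ] bettiCohomology X (2 * (n - 1))) ≃ₗ[K] (K ⊗[ℚ] bettiCohomology X (2 * (n - 1)))) :
    γ ∈ (BettiUniverse.hodge hHD hX (2 * (n - 1))).mumfordTateGroupBaseChange K ↔ ∃ c : Kˣ, γ = LinearEquiv.smulOfUnit c := by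
  haveI : Nontrivial (bettiCohomology X (2 * (n - 1))) := nontrivial_bettiCohomology_two_mul_of_le hX (by omega)
  exact (BettiUniverse.hodge hHD hX (2 * (n - 1))).mem_mumfordTateGroupBaseChange_iff_exists_eq_smulOfUnit_of_hodgeClasses_eq_top K
    (by have : 2 * (n - 1) ≠ 0 := by omega
        exact_mod_cast this) (p := ((n - 1 : ℕ) : ℤ)) (by push_cast; ring)
    ((BettiUniverse.hodgeClasses_hodge_curveDegree_eq_top_iff hHD hX (by omega)).2 h20) γ

/-- **`p_g(X) = 0 ⟹` every rational class of degree `2n − 2` is a CURVE class**: `v ⊗ 1 ∈ N^{n−1}H^{2n−2}(X(ℂ); ℂ)` for every `v ∈ H^{2n−2}(X(ℂ); ℚ)` (`n ≥ 1`; all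
classes are Hodge by §2, and the Hodge conjecture holds in degree `2n − 2` — hard Lefschetz `Lⁿ⁻²` + Lefschetz `(1,1)`, the tree's `mem_algebraicClasses_of_lefschetzRange_holds`).
[cite: KerrPearlstein2011, §3.1] [cite: VoisinHodgeI2002, Thm. 6.25, Rem. 6.27, §7.1.2 and Thm. 11.30] [cite: VoisinHodgeII2003, §11.1.1 (PDF p. 268)] -/
theorem ofRatClass_mem_algebraicClasses_curveDegree_of_pg_zero (hHD : exists_isReal_hodgeModel) (hX : IsSmoothProjective n X) (hn : 1 ≤ n)
    (h20 : (BettiUniverse.hodge hHD hX 2).hodgeNumber 2 0 = 0) (v : bettiCohomology X (2 * (n - 1))) :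
    ofRatClass (ComplexPoints X) (2 * (n - 1)) v ∈ algebraicClasses X (n - 1) := by
  have hv : v ∈ (BettiUniverse.hodge hHD hX (2 * (n - 1))).hodgeClasses (n - 1 : ℕ) := by
    rw [(BettiUniverse.hodgeClasses_hodge_curveDegree_eq_top_iff hHD hX hn).2 h20]
    exact Submodule.mem_top
  exact mem_algebraicClasses_of_lefschetzRange_holds hX (Or.inr (by omega)) _ (isRationalClass_ofRatClass _)
    ((BettiUniverse.mem_hodgeClasses_hodge_iff_isOfHodgeType hHD hX (n - 1) v).1 hv)

/-- The same keyed to Arapura's rendering `∃ A : HodgeModel n X, dim H^{2,0}_A = 0` of `p_g(X) = 0`. [cite: Arapura2022, proof of Cor. 1.5 (p. 5)]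
[cite: KerrPearlstein2011, §3.1] -/
theorem ofRatClass_mem_algebraicClasses_curveDegree_of_exists_hodgeModel (hX : IsSmoothProjective n X) (hn : 1 ≤ n)
    (hpg : ∃ A : HodgeModel n X, Module.finrank ℂ (A.hodgePQ 2 2 0) = 0) (v : bettiCohomology X (2 * (n - 1))) :
    ofRatClass (ComplexPoints X) (2 * (n - 1)) v ∈ algebraicClasses X (n - 1) := by
  obtain ⟨A, hA⟩ := hpg
  exact ofRatClass_mem_algebraicClasses_curveDegree_of_pg_zero exists_isReal_hodgeModel_holds hX hn
    ((BettiUniverse.hodgeNumber_hodge_two_zero_eq_zero_iff exists_isReal_hodgeModel_holds hX A).2 hA) v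

end Literature.AlgebraicGeometry.HodgeTheory

end
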